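import Mathlib
import Summits.ValiantsHypothesis.ValiantsHypothesis.Theorems.FeketeSOSCharPSparseSOSOrderedCoreTools

/-!
# Crux `FeketeSOS.CharPSparseSOS` (stmt-ValiantsHypothesis-14989) — the ORDERED analogue of (CORE) is a theorem

The wall of the cyclic crux (★) `CharPSparseSOS` is (CORE) (`coreSumClique_of_charPSparseSOS`, p146769): every weak-Sidon
set `Q ⊆ 𝔽_p` whose restricted sums `a + b` (`a ≠ b`, **mod `p`**) are quadratic residues has `|Q| ≤ √p − p^δ/2 + 9`
— an additive power below the counting bound `√p + 1/2`, for which no technique is on record.  The crux-strategist's census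
(`Cruxes/CharPSparseSOS/STRATEGY-CENSUS.md` §0, §Transfer T1) asserts that the ORDERED analogue — integer pair sums, no
reduction mod `p`, which is what the ordered shadow (★ord) of the door `valiantsHypothesis_of_ordered` (p152605) sees — is a
THEOREM, by Erdős's Sidon block count × Hilbert's inequality × Pólya–Vinogradov.  This file proves it:

* `orderedCoreSumClique` (registered sub-goal) — for `0 < δ ≤ 1/8` there is `p₀` such that for all primes `p ≥ p₀`, every
  weak-Sidon `Q ⊆ ℕ` whose restricted INTEGER pair sums lie in `[1, p)` and are quadratic residues mod `p` has
  `|Q| ≤ √p − p^δ`.  Proof: `orderedCore_quantitative` (part 1, `FeketeSOSCharPSparseSOSOrderedCoreTools.lean`) with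
  `L = ⌈p^{1/2+2δ}⌉`, the Pólya–Vinogradov loss absorbed by `1 + log p ≤ p^{2δ}`, and `log p ≥ 200`; the constants are
  generous (`5π + 3 < 25 = 200/8`).

So the entanglement of (★) with the Paley sum-clique problem is an artefact of the cyclic fold: on the ordered side the
near-counting-extremal Sidon configuration is excluded with a margin `(¼ − δ) log p` against `5π`.  (What the ordered
shadow must still exclude — `≳ log p`-piece packings at geometric scales, jittered digit grids, cancelling configurations —
is listed in the census §0/§T1′; none of it is a counting-bound improvement.)

Lead c7 of the crux; `--supports stmt-ValiantsHypothesis-14989`.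
-/

-- `Summit.ValiantsHypothesis.ValiantsHypothesis.…` is the tree's mandated single-conjunct layout (Sub = Summit).
set_option linter.dupNamespace false

namespace Summit.ValiantsHypothesis.ValiantsHypothesis.Theorems.CharPSparseSOSTwoCusp

open Finset

/-- **The ordered analogue of (CORE) is a theorem** (census `STRATEGY-CENSUS.md` §Transfer T1, "the ordered analogue of
(CORE) — an ordered weak-Sidon `Q ⊂ [0,p)` all of whose integer pair sums are QRs has `|Q| ≤ √p − p^δ` — is TRUE for
`p > e^{36/(1−4δ)}`"): for `0 < δ ≤ 1/8` there is `p₀` such that for every prime `p ≥ p₀`, every weak-Sidon `Q ⊆ ℕ`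
whose restricted INTEGER pair sums lie in `[1, p)` and are quadratic residues mod `p` has `|Q| ≤ √p − p^δ`.
Proof: `orderedCore_quantitative` with `L = ⌈p^{1/2+2δ}⌉`, Pólya–Vinogradov (`√p (1 + log p) ≤ √p · p^{2δ}`) and
`log p ≥ 200`; the constants are generous (`5π + 3 < 23 < 25 = 200/8`).  Contrast: cyclically (sums mod `p`) the
corresponding statement (CORE) is the square-root wall of the crux (`coreSumClique_of_charPSparseSOS`, p146769). -/
theorem orderedCoreSumClique : ∀ δ : ℝ, 0 < δ → δ ≤ 1 / 8 → ∃ p₀ : ℕ, ∀ (p : ℕ) [Fact p.Prime], p₀ ≤ p → ∀ Q : Finset ℕ, (∀ a ∈ Q, ∀ b ∈ Q, a < b → a + b < p ∧ legendreSym p (a + b) = 1) → (∀ a ∈ Q, ∀ b ∈ Q, ∀ c ∈ Q, ∀ d ∈ Q, a ≠ b → c ≠ d → a + b = c + d → (a = c ∧ b = d) ∨ (a = d ∧ b = c)) → (Q.card : ℝ) ≤ Real.sqrt p - (p : ℝ) ^ δ := by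
  intro δ hδ hδ8
  set A : ℝ := 1 + 1 / δ with hA
  have hA9 : 9 ≤ A := by
    have : 8 ≤ 1 / δ := by rw [le_div_iff₀ hδ]; linarith
    linarith
  have hA0 : 0 ≤ A := by linarith
  obtain ⟨N₁, hN₁⟩ : ∃ N₁ : ℕ, A ^ (1 / δ) ≤ (N₁ : ℝ) := ⟨_, Nat.le_ceil _⟩
  obtain ⟨N₂, hN₂⟩ : ∃ N₂ : ℕ, Real.exp 200 ≤ (N₂ : ℝ) := ⟨_, Nat.le_ceil _⟩
  refine ⟨max N₁ (max N₂ 41), ?_⟩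
  intro p inst hp Q hsum hws
  have hprime : p.Prime := Fact.out
  have hp41 : 41 ≤ p := le_trans (le_trans (le_max_right _ _) (le_max_right _ _)) hp
  have hpN₁ : N₁ ≤ p := le_trans (le_max_left _ _) hp
  have hpN₂ : N₂ ≤ p := le_trans (le_trans (le_max_left _ _) (le_max_right _ _)) hp
  have hp2 : p ≠ 2 := by omega
  have hpR : (41 : ℝ) ≤ p := by exact_mod_cast hp41
  have hp0 : (0 : ℝ) < p := by linarith
  have hp1 : (1 : ℝ) ≤ p := by linarith
  -- (f2) p^δ ≥ A ≥ 9
  have hpδA : A ≤ (p : ℝ) ^ δ := by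
    have h1 : A ^ (1 / δ) ≤ (p : ℝ) := hN₁.trans (by exact_mod_cast hpN₁)
    have h2 : (A ^ (1 / δ)) ^ δ ≤ (p : ℝ) ^ δ := Real.rpow_le_rpow (by positivity) h1 hδ.le
    rwa [← Real.rpow_mul hA0, one_div_mul_cancel hδ.ne', Real.rpow_one] at h2
  have hpδ1 : (1 : ℝ) ≤ (p : ℝ) ^ δ := Real.one_le_rpow hp1 hδ.le
  have hpδ0 : (0 : ℝ) ≤ (p : ℝ) ^ δ := by linarith
  -- (f3) log p ≥ 200
  have hlog : (200 : ℝ) ≤ Real.log p := by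
    have h1 : Real.exp 200 ≤ (p : ℝ) := hN₂.trans (by exact_mod_cast hpN₂)
    have := Real.log_le_log (Real.exp_pos _) h1
    rwa [Real.log_exp] at this
  have hlog0 : (0 : ℝ) ≤ Real.log p := by linarith
  -- (f4) 1 + log p ≤ p^{2δ} = p^δ · p^δ  (Pólya–Vinogradov loss absorbed)
  have h2δ : (p : ℝ) ^ (2 * δ) = (p : ℝ) ^ δ * (p : ℝ) ^ δ := by
    rw [two_mul, Real.rpow_add hp0]
  have hPV : 1 + Real.log p ≤ (p : ℝ) ^ (2 * δ) := by
    have h1 : Real.log p ≤ (p : ℝ) ^ δ / δ := Real.log_le_rpow_div (by linarith) hδ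
    have h2 : 1 + Real.log p ≤ A * (p : ℝ) ^ δ := by
      rw [hA, add_mul, one_mul, one_div_mul_eq_div]
      linarith
    rw [h2δ]
    exact h2.trans (mul_le_mul_of_nonneg_right hpδA hpδ0)
  have h8 : (8 : ℝ) ≤ (p : ℝ) ^ (2 * δ) := by
    have h9 : (9 : ℝ) ≤ (p : ℝ) ^ δ := hA9.trans hpδA
    rw [h2δ]
    have := mul_le_mul h9 h9 (by norm_num) hpδ0
    linarith
  -- the scale Λ = √p · p^{2δ} and L = ⌈Λ⌉
  have hsqrt : Real.sqrt p = (p : ℝ) ^ (1 / 2 : ℝ) := Real.sqrt_eq_rpow _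
  have hsqrt0 : 0 < Real.sqrt p := Real.sqrt_pos.2 hp0
  have hsqrt1 : (1 : ℝ) ≤ Real.sqrt p := by
    rw [show (1 : ℝ) = Real.sqrt 1 by simp]; exact Real.sqrt_le_sqrt hp1
  have hpp : Real.sqrt p * Real.sqrt p = p := Real.mul_self_sqrt hp0.le
  set Λ : ℝ := (p : ℝ) ^ (1 / 2 + 2 * δ) with hΛ
  have hΛeq : Λ = Real.sqrt p * (p : ℝ) ^ (2 * δ) := by
    rw [hΛ, hsqrt, ← Real.rpow_add hp0]
  have hΛ0 : 0 < Λ := by positivity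
  have hΛ1 : 1 ≤ Λ := by
    rw [hΛeq]
    exact one_le_mul_of_one_le_of_one_le hsqrt1 (by linarith)
  have hΛp : Λ ≤ (p : ℝ) := by
    rw [hΛ]
    calc (p : ℝ) ^ (1 / 2 + 2 * δ) ≤ (p : ℝ) ^ (1 : ℝ) :=
          Real.rpow_le_rpow_of_exponent_le hp1 (by linarith)
      _ = p := Real.rpow_one _
  set L : ℕ := ⌈Λ⌉₊ with hLdef
  have hLΛ : Λ ≤ (L : ℝ) := Nat.le_ceil _
  have hLΛ2 : (L : ℝ) ≤ 2 * Λ := (Nat.ceil_lt_add_one hΛ0.le).le.trans (by linarith)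
  have hL1 : 1 ≤ L := Nat.one_le_iff_ne_zero.2 (by rw [hLdef]; exact (Nat.ceil_pos.2 hΛ0).ne')
  have hLp : L ≤ p := by rw [hLdef]; exact Nat.ceil_le.2 (by exact_mod_cast hΛp)
  have hL0 : (0 : ℝ) < L := by exact_mod_cast (show 0 < L by omega)
  -- the set Q: counting and the size assumption
  by_contra hcon
  push Not at hcon
  have hcount := oc_counting p Q hsum hws
  -- p^δ ≤ √p / 2, so r := √p − p^δ ≥ √p/2 ≥ 3
  have hpδhalf : (p : ℝ) ^ δ ≤ Real.sqrt p / 2 := by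
    have h1 : (p : ℝ) ^ δ ≤ (p : ℝ) ^ (1 / 8 : ℝ) := Real.rpow_le_rpow_of_exponent_le hp1 hδ8
    have h2 : (2 : ℝ) ≤ (p : ℝ) ^ (3 / 8 : ℝ) := by
      have h3 : (2 : ℝ) ^ (8 / 3 : ℝ) ≤ p := by
        have : (2 : ℝ) ^ (8 / 3 : ℝ) ≤ (2 : ℝ) ^ (3 : ℝ) :=
          Real.rpow_le_rpow_of_exponent_le (by norm_num) (by norm_num)
        rw [show (2 : ℝ) ^ (3 : ℝ) = 8 by norm_num] at this
        linarith
      have h4 := Real.rpow_le_rpow (by positivity) h3 (show (0 : ℝ) ≤ 3 / 8 by norm_num)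
      rwa [← Real.rpow_mul (by norm_num), show (8 / 3 : ℝ) * (3 / 8) = 1 by norm_num, Real.rpow_one] at h4
    have h5 : (p : ℝ) ^ (1 / 8 : ℝ) * (p : ℝ) ^ (3 / 8 : ℝ) = Real.sqrt p := by
      rw [← Real.rpow_add hp0, hsqrt]; norm_num
    have h6 : 0 ≤ (p : ℝ) ^ (1 / 8 : ℝ) := by positivity
    have h7 : 2 * (p : ℝ) ^ (1 / 8 : ℝ) ≤ Real.sqrt p := by
      rw [← h5, mul_comm]
      exact mul_le_mul_of_nonneg_left h2 h6
    linarith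
  have hq0 : (0 : ℝ) < (Q.card : ℝ) := by
    have : 0 ≤ Real.sqrt p - (p : ℝ) ^ δ := by linarith [hsqrt0.le]
    linarith
  have hq1 : 1 ≤ Q.card := by exact_mod_cast hq0
  -- q ≤ 2 √p
  have hq2 : (Q.card : ℝ) ≤ 2 * Real.sqrt p := by
    by_contra h
    push Not at h
    have h3 : Real.sqrt p ≤ (Q.card : ℝ) - 1 := by linarith
    have h4 : 2 * Real.sqrt p * Real.sqrt p < (Q.card : ℝ) * ((Q.card : ℝ) - 1) :=
      mul_lt_mul h h3 hsqrt0 hq0.le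
    have e : (Q.card : ℝ) * ((Q.card : ℝ) - 1) = (Q.card : ℝ) ^ 2 - Q.card := by ring
    rw [mul_assoc, hpp, e] at h4
    linarith
  -- 4q ≤ L
  have h4q : 4 * Q.card ≤ L := by
    have h1 : (4 * Q.card : ℝ) ≤ Λ := by
      rw [hΛeq]
      calc (4 * Q.card : ℝ) ≤ 4 * (2 * Real.sqrt p) := by linarith
        _ = Real.sqrt p * 8 := by ring
        _ ≤ Real.sqrt p * (p : ℝ) ^ (2 * δ) := mul_le_mul_of_nonneg_left h8 hsqrt0.le
    have : ((4 * Q.card : ℕ) : ℝ) ≤ (L : ℝ) := by push_cast; exact h1.trans hLΛ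
    exact_mod_cast this
  -- the quantitative core
  have hcore := orderedCore_quantitative p hp2 Q L hL1 hLp hsum hws hq1 h4q
  set W : ℝ := Real.sqrt p * (1 + Real.log p) with hW
  have hW0 : 0 ≤ W := by positivity
  -- W ≤ Λ ≤ L
  have hWΛ : W ≤ Λ := by rw [hW, hΛeq]; exact mul_le_mul_of_nonneg_left hPV hsqrt0.le
  have hWL : W ≤ L := hWΛ.trans hLΛ
  -- deficiency bound: (p−1)/2 + W/2 − q(q−1)/2 ≤ (3/2) √p p^δ + W/2
  have hdefic : ((p : ℝ) - 1) / 2 + W / 2 - (Q.card : ℝ) * ((Q.card : ℝ) - 1) / 2 ≤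
      3 / 2 * (Real.sqrt p * (p : ℝ) ^ δ) + W / 2 := by
    set r : ℝ := Real.sqrt p - (p : ℝ) ^ δ with hr
    have hr1 : 1 ≤ r := by
      have : (6 : ℝ) ≤ Real.sqrt p := by
        rw [show (6 : ℝ) = Real.sqrt 36 by
          rw [show (36 : ℝ) = 6 ^ 2 by norm_num, Real.sqrt_sq (by norm_num)]]
        exact Real.sqrt_le_sqrt (by linarith)
      linarith
    have hprod : 0 ≤ ((Q.card : ℝ) - r) * ((Q.card : ℝ) + r - 1) :=
      mul_nonneg (by linarith) (by linarith)
    have e1 : ((Q.card : ℝ) - r) * ((Q.card : ℝ) + r - 1) =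
        (Q.card : ℝ) * ((Q.card : ℝ) - 1) - r * (r - 1) := by ring
    have e2 : r * (r - 1) = Real.sqrt p * Real.sqrt p - 2 * (Real.sqrt p * (p : ℝ) ^ δ)
        + (p : ℝ) ^ δ * (p : ℝ) ^ δ - Real.sqrt p + (p : ℝ) ^ δ := by rw [hr]; ring
    have hsq : 0 ≤ (p : ℝ) ^ δ * (p : ℝ) ^ δ := mul_nonneg hpδ0 hpδ0
    have hsp : Real.sqrt p ≤ Real.sqrt p * (p : ℝ) ^ δ := le_mul_of_one_le_right hsqrt0.le hpδ1
    rw [e1, e2, hpp] at hprod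
    linarith
  have hDL : (((p : ℝ) - 1) / 2 + W / 2 - (Q.card : ℝ) * ((Q.card : ℝ) - 1) / 2) / L ≤ 2 := by
    have hspΛ : Real.sqrt p * (p : ℝ) ^ δ ≤ Λ := by
      rw [hΛeq, h2δ]
      exact mul_le_mul_of_nonneg_left (le_mul_of_one_le_right hpδ0 hpδ1) hsqrt0.le
    have h1 : (3 / 2 * (Real.sqrt p * (p : ℝ) ^ δ) + W / 2) / L ≤ 2 := by
      rw [div_le_iff₀ hL0]
      linarith
    exact (div_le_div_of_nonneg_right hdefic hL0.le).trans h1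
  have hW2L : W / (2 * L) ≤ 1 / 2 := by
    rw [div_le_iff₀ (by positivity)]; linarith
  -- log (p / L) ≥ (1/2 − 2δ) log p − log 2
  have hlogpL : (1 / 2 - 2 * δ) * Real.log p - Real.log 2 ≤ Real.log ((p : ℝ) / L) := by
    have h1 : Real.log ((p : ℝ) / L) = Real.log p - Real.log L := Real.log_div hp0.ne' hL0.ne'
    have h2 : Real.log L ≤ Real.log (2 * Λ) := Real.log_le_log hL0 hLΛ2
    have h3 : Real.log (2 * Λ) = Real.log 2 + (1 / 2 + 2 * δ) * Real.log p := by
      rw [Real.log_mul (by norm_num) hΛ0.ne', hΛ, Real.log_rpow hp0]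
    rw [h1]; linarith
  have hlog2 : Real.log 2 < 1 := by
    have := Real.log_two_lt_d9; linarith
  have hpi : Real.pi < 4 := Real.pi_lt_four
  have hδterm : (1 / 4 : ℝ) * Real.log p ≤ (1 / 2 - 2 * δ) * Real.log p := by
    have : 0 ≤ (1 / 2 - 2 * δ - 1 / 4) * Real.log p := mul_nonneg (by linarith) hlog0
    linarith
  -- contradiction
  linarith [hcore, hDL, hW2L, hlogpL, hlog2, hpi, hδterm, hlog]

end Summit.ValiantsHypothesis.ValiantsHypothesis.Theorems.CharPSparseSOSTwoCusp
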